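import Mathlib
import Summits.ValiantsHypothesis.ValiantsHypothesis.Theorems.NewtonUnitEquationsDissociatedUniformTotalsLaw
import Summits.ValiantsHypothesis.ValiantsHypothesis.Theorems.NewtonUnitEquationsDissociatedUniformTotalsLawShallowAll
import Summits.ValiantsHypothesis.ValiantsHypothesis.Theorems.NewtonUnitEquationsDissociatedUniformTotalsLawChartLevelsTopSets
import Summits.ValiantsHypothesis.ValiantsHypothesis.Theorems.NewtonUnitEquationsDissociatedUniformTotalsLawKShallow
import Literature.Computability.AlgebraicComplexity.NewtonPolygonTauProductBounds
import HarnessLib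

/-!
# Crux `NewtonUnitEquations.DissociatedUniform` (stmt-ValiantsHypothesis-5905): the `n = 3` totals law — the graded `k`-SHALLOW / `k`-DEEP
# dichotomy `T ≤ O(k²|G|²) + #k-deep`

Companion of `…TotalsLawKShallow` (`sum_card_kshallow_le`: vertices whose third letter is among the top `k` of `C` at an exposing weight
number `≤ k(V_P + 2|G|) + 2|G|(k+1)(16|G|k+1)`) and `…TotalsLawShallowAll` (the `k = 1` dichotomy, `classImage_rotate`).  Here the letters
are rotated as there:
* `card_kshallowA_le` / `card_kshallowB_le`, **`sum_card_kshallowA_le`**, **`sum_card_kshallowB_le`**;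
* **`totalVert_le_kshallow_add_kdeep`** — `a, b, c` injective, `k ≥ 1`:
  `T ≤ k(V_P + V_Q + V_R + 6|G|) + 6|G|(k+1)(16|G|k+1) + ∑_s #k-deep(s)`, where a hull vertex is `k`-DEEP if at no exposing chart weight
  does any spelling have a letter among the top `k` of its alphabet; coarse form `totalVert_le_sq_add_kdeep`;
* **`totalVert_le_of_no_kdeep`** — no `k`-deep vertex ⇒ `T ≤ 3k|G|² + 6k|G| + 6|G|(k+1)(16|G|k+1) = O(k²|G|²)`.
So for every fixed `k` the `n = 3` law is equivalent to `∑_s #k-deep(s) = O(|G|²)`; a bound `#k-deep ≤ C|G|³/k²` for some `k = k(|G|) → ∞`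
would give the first sub-cubic general bound (memo `Cruxes/DissociatedUniform/NOTES-t1g11.md` §3).
Honest label: unconditional structure theorems; the law itself remains OPEN; nothing here bears on VP ≠ VNP.
[folklore]
-/

set_option linter.dupNamespace false -- `ValiantsHypothesis.ValiantsHypothesis` (summit = problem) in every name

open scoped BigOperators
open Matrix Finset

namespace Summit.ValiantsHypothesis.ValiantsHypothesis.Theorems.NewtonUnitEquationsDissociatedUniform

namespace TotalsLaw

open Literature.Computability.AlgebraicComplexity.KPTT.PlanarMinkowski

variable {G : Type*} [AddCommGroup G] [Fintype G]

/-! ### Rotating the letters at finset level -/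

/-! ### `k`-shallow in `a` / in `b` via the third-letter theorem -/

open Classical in
/-- **`k`-shallow in `a`, one class**: a spelling of a vertex of class `s` of `(a,b,c)` with first letter among the top `k` of `A` is
a third-letter spelling of the same vertex of the same class of `(b,c,a)`. [folklore] -/
theorem card_kshallowA_le (a b c : G → (Fin 2 → ℝ)) (k : ℕ) (s : G) :
    ((Finset.univ.image fun p : G × G => a p.1 + b p.2 + c (s - p.1 - p.2)).filter fun v =>
        ∃ σ t : ℝ, (σ = 1 ∨ σ = -1) ∧ ∃ p : G × G, a p.1 + b p.2 + c (s - p.1 - p.2) = v ∧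
          IsStrictTop ![σ, t] (Finset.univ.image fun p : G × G => a p.1 + b p.2 + c (s - p.1 - p.2)) v ∧
          rank σ (Finset.univ.image a) t (a p.1) < k).card ≤
      ((Finset.univ.image fun p : G × G => b p.1 + c p.2 + a (s - p.1 - p.2)).filter fun v =>
        ∃ σ t : ℝ, (σ = 1 ∨ σ = -1) ∧ ∃ p : G × G, b p.1 + c p.2 + a (s - p.1 - p.2) = v ∧
          IsStrictTop ![σ, t] (Finset.univ.image fun p : G × G => b p.1 + c p.2 + a (s - p.1 - p.2)) v ∧
          rank σ (Finset.univ.image a) t (a (s - p.1 - p.2)) < k).card := by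
  refine Finset.card_le_card fun v hv => ?_
  rw [← classImage_rotate a b c s]
  obtain ⟨hvF, σ, t, hσ, ⟨x, y⟩, hp, htop, hA⟩ := Finset.mem_filter.1 hv
  refine Finset.mem_filter.2 ⟨hvF, σ, t, hσ, (y, s - x - y), ?_, htop, ?_⟩
  · rw [← hp]
    have : s - y - (s - x - y) = x := by abel
    simp only [this]
    abel
  · have : s - y - (s - x - y) = x := by abel
    simp only [this]
    exact hA

open Classical in
/-- **`k`-shallow in `b`, one class**: a second-letter spelling for `(a,b,c)` is a third-letter spelling for `(c,a,b)`. [folklore] -/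
theorem card_kshallowB_le (a b c : G → (Fin 2 → ℝ)) (k : ℕ) (s : G) :
    ((Finset.univ.image fun p : G × G => a p.1 + b p.2 + c (s - p.1 - p.2)).filter fun v =>
        ∃ σ t : ℝ, (σ = 1 ∨ σ = -1) ∧ ∃ p : G × G, a p.1 + b p.2 + c (s - p.1 - p.2) = v ∧
          IsStrictTop ![σ, t] (Finset.univ.image fun p : G × G => a p.1 + b p.2 + c (s - p.1 - p.2)) v ∧
          rank σ (Finset.univ.image b) t (b p.2) < k).card ≤
      ((Finset.univ.image fun p : G × G => c p.1 + a p.2 + b (s - p.1 - p.2)).filter fun v =>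
        ∃ σ t : ℝ, (σ = 1 ∨ σ = -1) ∧ ∃ p : G × G, c p.1 + a p.2 + b (s - p.1 - p.2) = v ∧
          IsStrictTop ![σ, t] (Finset.univ.image fun p : G × G => c p.1 + a p.2 + b (s - p.1 - p.2)) v ∧
          rank σ (Finset.univ.image b) t (b (s - p.1 - p.2)) < k).card := by
  refine Finset.card_le_card fun v hv => ?_
  have hrot : (Finset.univ.image fun p : G × G => a p.1 + b p.2 + c (s - p.1 - p.2)) =
      Finset.univ.image fun p : G × G => c p.1 + a p.2 + b (s - p.1 - p.2) := by
    rw [classImage_rotate a b c s, classImage_rotate b c a s]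
  rw [← hrot]
  obtain ⟨hvF, σ, t, hσ, ⟨x, y⟩, hp, htop, hB⟩ := Finset.mem_filter.1 hv
  refine Finset.mem_filter.2 ⟨hvF, σ, t, hσ, (s - x - y, x), ?_, htop, ?_⟩
  · rw [← hp]
    have : s - (s - x - y) - x = y := by abel
    simp only [this]
    abel
  · have : s - (s - x - y) - x = y := by abel
    simp only [this]
    exact hB

open Classical in
/-- **`∑_s #{k-shallow-in-a vertices} ≤ k(V_Q + 2|G|) + 2|G|(k+1)(16|G|k+1)`** for `a` injective, `k ≥ 1`. [folklore] -/
theorem sum_card_kshallowA_le (a b c : G → (Fin 2 → ℝ)) (ha : Function.Injective a) {k : ℕ} (hk : 1 ≤ k) :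
    ∑ s, ((Finset.univ.image fun p : G × G => a p.1 + b p.2 + c (s - p.1 - p.2)).filter fun v =>
        ∃ σ t : ℝ, (σ = 1 ∨ σ = -1) ∧ ∃ p : G × G, a p.1 + b p.2 + c (s - p.1 - p.2) = v ∧
          IsStrictTop ![σ, t] (Finset.univ.image fun p : G × G => a p.1 + b p.2 + c (s - p.1 - p.2)) v ∧
          rank σ (Finset.univ.image a) t (a p.1) < k).card ≤
      k * (fibreTotal b c + 2 * Fintype.card G) + 2 * (Fintype.card G * (k + 1) * (16 * Fintype.card G * k + 1)) :=
  (Finset.sum_le_sum fun s _ => card_kshallowA_le a b c k s).trans (sum_card_kshallow_le b c a ha hk)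

open Classical in
/-- **`∑_s #{k-shallow-in-b vertices} ≤ k(V_R + 2|G|) + 2|G|(k+1)(16|G|k+1)`** for `b` injective, `k ≥ 1`. [folklore] -/
theorem sum_card_kshallowB_le (a b c : G → (Fin 2 → ℝ)) (hb : Function.Injective b) {k : ℕ} (hk : 1 ≤ k) :
    ∑ s, ((Finset.univ.image fun p : G × G => a p.1 + b p.2 + c (s - p.1 - p.2)).filter fun v =>
        ∃ σ t : ℝ, (σ = 1 ∨ σ = -1) ∧ ∃ p : G × G, a p.1 + b p.2 + c (s - p.1 - p.2) = v ∧
          IsStrictTop ![σ, t] (Finset.univ.image fun p : G × G => a p.1 + b p.2 + c (s - p.1 - p.2)) v ∧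
          rank σ (Finset.univ.image b) t (b p.2) < k).card ≤
      k * (fibreTotal c a + 2 * Fintype.card G) + 2 * (Fintype.card G * (k + 1) * (16 * Fintype.card G * k + 1)) :=
  (Finset.sum_le_sum fun s _ => card_kshallowB_le a b c k s).trans (sum_card_kshallow_le c a b hb hk)

/-! ### The dichotomy -/

open Classical in
/-- **`T ≤ k(V_P + V_Q + V_R + 6|G|) + 6|G|(k+1)(16|G|k+1) + ∑_s #k-deep(s)`** for injective letters and `k ≥ 1`: every hull vertex
of a class is `k`-shallow in `a`, in `b`, in `c`, or `k`-DEEP (none), and the three `k`-shallow families are bounded by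
`…TotalsLawKShallow.sum_card_kshallow_le` and its rotations. [folklore] -/
theorem totalVert_le_kshallow_add_kdeep (a b c : G → (Fin 2 → ℝ)) (ha : Function.Injective a) (hb : Function.Injective b)
    (hc : Function.Injective c) {k : ℕ} (hk : 1 ≤ k) :
    totalVert a b c ≤
      k * (fibreTotal a b + fibreTotal b c + fibreTotal c a + 6 * Fintype.card G) +
      6 * (Fintype.card G * (k + 1) * (16 * Fintype.card G * k + 1)) +
      ∑ s, ((Finset.univ.image fun p : G × G => a p.1 + b p.2 + c (s - p.1 - p.2)).filter fun v =>
        v ∈ (convexHull ℝ (classPts a b c s)).extremePoints ℝ ∧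
        ¬ (∃ σ t : ℝ, (σ = 1 ∨ σ = -1) ∧ ∃ p : G × G, a p.1 + b p.2 + c (s - p.1 - p.2) = v ∧
          IsStrictTop ![σ, t] (Finset.univ.image fun p : G × G => a p.1 + b p.2 + c (s - p.1 - p.2)) v ∧
          (rank σ (Finset.univ.image a) t (a p.1) < k ∨ rank σ (Finset.univ.image b) t (b p.2) < k ∨
            rank σ (Finset.univ.image c) t (c (s - p.1 - p.2)) < k))).card := by
  classical
  have hA := sum_card_kshallowA_le a b c ha hk
  have hB := sum_card_kshallowB_le a b c hb hk
  have hC := sum_card_kshallow_le a b c hc hk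
  -- per class: vertices ⊆ shallowA ∪ shallowB ∪ shallowC ∪ deep
  have hcl : ∀ s : G, classVert a b c s ≤
      ((Finset.univ.image fun p : G × G => a p.1 + b p.2 + c (s - p.1 - p.2)).filter fun v =>
        ∃ σ t : ℝ, (σ = 1 ∨ σ = -1) ∧ ∃ p : G × G, a p.1 + b p.2 + c (s - p.1 - p.2) = v ∧
          IsStrictTop ![σ, t] (Finset.univ.image fun p : G × G => a p.1 + b p.2 + c (s - p.1 - p.2)) v ∧
          rank σ (Finset.univ.image a) t (a p.1) < k).card +
      ((Finset.univ.image fun p : G × G => a p.1 + b p.2 + c (s - p.1 - p.2)).filter fun v =>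
        ∃ σ t : ℝ, (σ = 1 ∨ σ = -1) ∧ ∃ p : G × G, a p.1 + b p.2 + c (s - p.1 - p.2) = v ∧
          IsStrictTop ![σ, t] (Finset.univ.image fun p : G × G => a p.1 + b p.2 + c (s - p.1 - p.2)) v ∧
          rank σ (Finset.univ.image b) t (b p.2) < k).card +
      ((Finset.univ.image fun p : G × G => a p.1 + b p.2 + c (s - p.1 - p.2)).filter fun v =>
        ∃ σ t : ℝ, (σ = 1 ∨ σ = -1) ∧ ∃ p : G × G, a p.1 + b p.2 + c (s - p.1 - p.2) = v ∧
          IsStrictTop ![σ, t] (Finset.univ.image fun p : G × G => a p.1 + b p.2 + c (s - p.1 - p.2)) v ∧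
          rank σ (Finset.univ.image c) t (c (s - p.1 - p.2)) < k).card +
      ((Finset.univ.image fun p : G × G => a p.1 + b p.2 + c (s - p.1 - p.2)).filter fun v =>
        v ∈ (convexHull ℝ (classPts a b c s)).extremePoints ℝ ∧
        ¬ (∃ σ t : ℝ, (σ = 1 ∨ σ = -1) ∧ ∃ p : G × G, a p.1 + b p.2 + c (s - p.1 - p.2) = v ∧
          IsStrictTop ![σ, t] (Finset.univ.image fun p : G × G => a p.1 + b p.2 + c (s - p.1 - p.2)) v ∧
          (rank σ (Finset.univ.image a) t (a p.1) < k ∨ rank σ (Finset.univ.image b) t (b p.2) < k ∨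
            rank σ (Finset.univ.image c) t (c (s - p.1 - p.2)) < k))).card := by
    intro s
    set F := Finset.univ.image fun p : G × G => a p.1 + b p.2 + c (s - p.1 - p.2) with hF
    have hcoe : (F : Set (Fin 2 → ℝ)) = classPts a b c s := by
      rw [hF, Finset.coe_image, Finset.coe_univ, Set.image_univ]; rfl
    set SA := F.filter fun v => ∃ σ t : ℝ, (σ = 1 ∨ σ = -1) ∧ ∃ p : G × G, a p.1 + b p.2 + c (s - p.1 - p.2) = v ∧
      IsStrictTop ![σ, t] F v ∧ rank σ (Finset.univ.image a) t (a p.1) < k with hSA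
    set SB := F.filter fun v => ∃ σ t : ℝ, (σ = 1 ∨ σ = -1) ∧ ∃ p : G × G, a p.1 + b p.2 + c (s - p.1 - p.2) = v ∧
      IsStrictTop ![σ, t] F v ∧ rank σ (Finset.univ.image b) t (b p.2) < k with hSB
    set SC := F.filter fun v => ∃ σ t : ℝ, (σ = 1 ∨ σ = -1) ∧ ∃ p : G × G, a p.1 + b p.2 + c (s - p.1 - p.2) = v ∧
      IsStrictTop ![σ, t] F v ∧ rank σ (Finset.univ.image c) t (c (s - p.1 - p.2)) < k with hSC
    set D := F.filter fun v => v ∈ (convexHull ℝ (classPts a b c s)).extremePoints ℝ ∧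
      ¬ (∃ σ t : ℝ, (σ = 1 ∨ σ = -1) ∧ ∃ p : G × G, a p.1 + b p.2 + c (s - p.1 - p.2) = v ∧
        IsStrictTop ![σ, t] F v ∧
        (rank σ (Finset.univ.image a) t (a p.1) < k ∨ rank σ (Finset.univ.image b) t (b p.2) < k ∨
          rank σ (Finset.univ.image c) t (c (s - p.1 - p.2)) < k)) with hD
    have hsub : (convexHull ℝ (classPts a b c s)).extremePoints ℝ ⊆ ((SA ∪ SB ∪ SC ∪ D : Finset (Fin 2 → ℝ)) : Set (Fin 2 → ℝ)) := by
      intro v hv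
      have hvF : v ∈ F := by rw [← Finset.mem_coe, hcoe]; exact extremePoints_convexHull_subset hv
      rw [Finset.coe_union, Finset.coe_union, Finset.coe_union]
      simp only [Set.mem_union, Finset.mem_coe]
      by_cases h : ∃ σ t : ℝ, (σ = 1 ∨ σ = -1) ∧ ∃ p : G × G, a p.1 + b p.2 + c (s - p.1 - p.2) = v ∧
          IsStrictTop ![σ, t] F v ∧
          (rank σ (Finset.univ.image a) t (a p.1) < k ∨ rank σ (Finset.univ.image b) t (b p.2) < k ∨
            rank σ (Finset.univ.image c) t (c (s - p.1 - p.2)) < k)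
      · obtain ⟨σ, t, hσ, p, hp, htop, hl | hl | hl⟩ := h
        · exact Or.inl (Or.inl (Or.inl (Finset.mem_filter.2 ⟨hvF, σ, t, hσ, p, hp, htop, hl⟩)))
        · exact Or.inl (Or.inl (Or.inr (Finset.mem_filter.2 ⟨hvF, σ, t, hσ, p, hp, htop, hl⟩)))
        · exact Or.inl (Or.inr (Finset.mem_filter.2 ⟨hvF, σ, t, hσ, p, hp, htop, hl⟩))
      · exact Or.inr (Finset.mem_filter.2 ⟨hvF, hv, h⟩)
    unfold classVert
    calc ((convexHull ℝ (classPts a b c s)).extremePoints ℝ).ncard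
        ≤ (((SA ∪ SB ∪ SC ∪ D : Finset (Fin 2 → ℝ))) : Set (Fin 2 → ℝ)).ncard :=
          Set.ncard_le_ncard hsub (Finset.finite_toSet _)
      _ = (SA ∪ SB ∪ SC ∪ D).card := Set.ncard_coe_finset _
      _ ≤ (SA ∪ SB ∪ SC).card + D.card := Finset.card_union_le _ _
      _ ≤ (SA ∪ SB).card + SC.card + D.card := Nat.add_le_add_right (Finset.card_union_le _ _) _
      _ ≤ SA.card + SB.card + SC.card + D.card :=
          Nat.add_le_add_right (Nat.add_le_add_right (Finset.card_union_le _ _) _) _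
  unfold totalVert
  calc ∑ s, classVert a b c s ≤ _ := Finset.sum_le_sum fun s _ => hcl s
    _ ≤ _ := by
        rw [Finset.sum_add_distrib, Finset.sum_add_distrib, Finset.sum_add_distrib]
        have := add_le_add (add_le_add hA hB) hC
        calc _ ≤ k * (fibreTotal b c + 2 * Fintype.card G) + 2 * (Fintype.card G * (k + 1) * (16 * Fintype.card G * k + 1)) +
              (k * (fibreTotal c a + 2 * Fintype.card G) + 2 * (Fintype.card G * (k + 1) * (16 * Fintype.card G * k + 1))) +
              (k * (fibreTotal a b + 2 * Fintype.card G) + 2 * (Fintype.card G * (k + 1) * (16 * Fintype.card G * k + 1))) +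
              ∑ s, ((Finset.univ.image fun p : G × G => a p.1 + b p.2 + c (s - p.1 - p.2)).filter fun v =>
                v ∈ (convexHull ℝ (classPts a b c s)).extremePoints ℝ ∧
                ¬ (∃ σ t : ℝ, (σ = 1 ∨ σ = -1) ∧ ∃ p : G × G, a p.1 + b p.2 + c (s - p.1 - p.2) = v ∧
                  IsStrictTop ![σ, t] (Finset.univ.image fun p : G × G => a p.1 + b p.2 + c (s - p.1 - p.2)) v ∧
                  (rank σ (Finset.univ.image a) t (a p.1) < k ∨ rank σ (Finset.univ.image b) t (b p.2) < k ∨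
                    rank σ (Finset.univ.image c) t (c (s - p.1 - p.2)) < k))).card := Nat.add_le_add_right this _
          _ = _ := by ring

open Classical in
/-- Coarse form: **`T ≤ 3k|G|² + 6k|G| + 6|G|(k+1)(16|G|k+1) + ∑_s #k-deep(s)`** (`V_X ≤ |G|²`). [folklore] -/
theorem totalVert_le_sq_add_kdeep (a b c : G → (Fin 2 → ℝ)) (ha : Function.Injective a) (hb : Function.Injective b)
    (hc : Function.Injective c) {k : ℕ} (hk : 1 ≤ k) :
    totalVert a b c ≤ 3 * k * Fintype.card G ^ 2 + 6 * k * Fintype.card G +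
      6 * (Fintype.card G * (k + 1) * (16 * Fintype.card G * k + 1)) +
      ∑ s, ((Finset.univ.image fun p : G × G => a p.1 + b p.2 + c (s - p.1 - p.2)).filter fun v =>
        v ∈ (convexHull ℝ (classPts a b c s)).extremePoints ℝ ∧
        ¬ (∃ σ t : ℝ, (σ = 1 ∨ σ = -1) ∧ ∃ p : G × G, a p.1 + b p.2 + c (s - p.1 - p.2) = v ∧
          IsStrictTop ![σ, t] (Finset.univ.image fun p : G × G => a p.1 + b p.2 + c (s - p.1 - p.2)) v ∧
          (rank σ (Finset.univ.image a) t (a p.1) < k ∨ rank σ (Finset.univ.image b) t (b p.2) < k ∨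
            rank σ (Finset.univ.image c) t (c (s - p.1 - p.2)) < k))).card := by
  classical
  have h := totalVert_le_kshallow_add_kdeep a b c ha hb hc hk
  have h1 : fibreTotal a b ≤ Fintype.card G ^ 2 := fibreTotal_le_card_sq a b
  have h2 : fibreTotal b c ≤ Fintype.card G ^ 2 := fibreTotal_le_card_sq b c
  have h3 : fibreTotal c a ≤ Fintype.card G ^ 2 := fibreTotal_le_card_sq c a
  have h4 : k * (fibreTotal a b + fibreTotal b c + fibreTotal c a + 6 * Fintype.card G) ≤
      k * (3 * Fintype.card G ^ 2 + 6 * Fintype.card G) := Nat.mul_le_mul_left _ (by omega)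
  have h5 : k * (3 * Fintype.card G ^ 2 + 6 * Fintype.card G) = 3 * k * Fintype.card G ^ 2 + 6 * k * Fintype.card G := by ring
  omega

open Classical in
/-- **No `k`-deep vertex ⇒ `T ≤ 3k|G|² + 6k|G| + 6|G|(k+1)(16|G|k+1) = O(k²|G|²)`.**  If every hull vertex of every class has, at some
chart weight exposing it, a spelling with a letter among the top `k` of its alphabet, the `n = 3` totals law holds with constant `O(k²)`.
[folklore] -/
theorem totalVert_le_of_no_kdeep (a b c : G → (Fin 2 → ℝ)) (ha : Function.Injective a) (hb : Function.Injective b)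
    (hc : Function.Injective c) {k : ℕ} (hk : 1 ≤ k)
    (hnodeep : ∀ (s : G) (v : Fin 2 → ℝ), v ∈ (convexHull ℝ (classPts a b c s)).extremePoints ℝ →
      ∃ σ t : ℝ, (σ = 1 ∨ σ = -1) ∧ ∃ p : G × G, a p.1 + b p.2 + c (s - p.1 - p.2) = v ∧
        IsStrictTop ![σ, t] (Finset.univ.image fun p : G × G => a p.1 + b p.2 + c (s - p.1 - p.2)) v ∧
        (rank σ (Finset.univ.image a) t (a p.1) < k ∨ rank σ (Finset.univ.image b) t (b p.2) < k ∨
          rank σ (Finset.univ.image c) t (c (s - p.1 - p.2)) < k)) :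
    totalVert a b c ≤ 3 * k * Fintype.card G ^ 2 + 6 * k * Fintype.card G +
      6 * (Fintype.card G * (k + 1) * (16 * Fintype.card G * k + 1)) := by
  classical
  have h := totalVert_le_sq_add_kdeep a b c ha hb hc hk
  have hzero : ∀ s : G, ((Finset.univ.image fun p : G × G => a p.1 + b p.2 + c (s - p.1 - p.2)).filter fun v =>
        v ∈ (convexHull ℝ (classPts a b c s)).extremePoints ℝ ∧
        ¬ (∃ σ t : ℝ, (σ = 1 ∨ σ = -1) ∧ ∃ p : G × G, a p.1 + b p.2 + c (s - p.1 - p.2) = v ∧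
          IsStrictTop ![σ, t] (Finset.univ.image fun p : G × G => a p.1 + b p.2 + c (s - p.1 - p.2)) v ∧
          (rank σ (Finset.univ.image a) t (a p.1) < k ∨ rank σ (Finset.univ.image b) t (b p.2) < k ∨
            rank σ (Finset.univ.image c) t (c (s - p.1 - p.2)) < k))).card = 0 := by
    intro s
    rw [Finset.card_eq_zero, Finset.filter_eq_empty_iff]
    intro v _ hv
    exact hv.2 (hnodeep s v hv.1)
  simp only [hzero, Finset.sum_const_zero, add_zero] at h
  exact h

end TotalsLaw

end Summit.ValiantsHypothesis.ValiantsHypothesis.Theorems.NewtonUnitEquationsDissociatedUniform
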